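import Mathlib
import HarnessLib
import Summits.NavierStokesRegularity.NavierStokesRegularity.Theorems.UnthreadedDoorNetFluxUnimodalScalarLiouville
import Summits.NavierStokesRegularity.NavierStokesRegularity.Theorems.UnthreadedDoorVorticityOfClass
import Summits.NavierStokesRegularity.NavierStokesRegularity.Theorems.UnthreadedDoorToroidalPotential
import Summits.NavierStokesRegularity.NavierStokesRegularity.Theorems.UnthreadedDoorPotentialEvolution
import Summits.NavierStokesRegularity.NavierStokesRegularity.Theorems.UnthreadedDoorConstantOfIrrotational

/-!
# Route `UnthreadedDoor`, crux `PoloidalLiouville` (stmt-NavierStokesRegularity-1222), WALL W1 `stub_scalarLiouville` —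
# C⁻ `PoloidalLiouvilleTypeI` MODULO THE TYPED RESIDUAL `MultiHillScalarLiouvilleTypeI` (Theorems-side bookkeeping, by name)

KEY-NS #170 (2) (director-ns g17).  The netflux line's bookkeeping theorem `poloidalLiouvilleTypeI_of_line` (Lines file, §3) closes the
Type-I sub-crux C⁻ = `FarPastCollapse.PoloidalLiouvilleTypeI` from: the four v2 COMPANION stubs `StubVorticityOfClass`, `StubToroidalPotential`,
`StubPotentialEvolution`, `StubConstantOfIrrotational` — ALL FOUR already landed theorems with verbatim statements
(`Theorems.PoloidalLiouville.stub_vorticityOfClass` p629171, `stub_toroidalPotential`, `stub_potentialEvolution` p631436,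
`stub_constantOfIrrotational` p632253) —, the line's RUNG `UnimodalScalarLiouvilleTypeI` (now a theorem: `unimodalScalarLiouvilleTypeI_holds`,
p675773, netflux chain NF-0…NF-6) and the typed RESIDUAL `MultiHillScalarLiouvilleTypeI` (some sphere at some time carries a saddle; OPEN,
wall-class).  This file runs that composition Theorems-side, so that C⁻ is a theorem MODULO EXACTLY ONE NAMED HYPOTHESIS:

* `scalarLiouvilleTypeI_of_multiHill` — the residual gives g0's Type-I wall `FarPastCollapse.StubScalarLiouvilleTypeI` (body verbatim): case
  split on «every sphere saddle-free at every time» (rung) / «some sphere carries a saddle» (residual), as the sketch's `wallTypeI_of_split`;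
* `poloidalLiouvilleTypeI_of_multiHill` — the residual gives C⁻ (body of `FarPastCollapse.PoloidalLiouvilleTypeI` verbatim, `IsTypeIUnthreaded`
  unfolded): vorticity of class → toroidal potential → (E1) → the Type-I wall → constancy of irrotational slices, as the sketch's
  `PoloidalLiouvilleTypeI_of_stubs`.

HONEST LABEL: bookkeeping only — the residual `MultiHillScalarLiouvilleTypeI` is the wall-class open piece and is NOT touched; C⁻, the crux
`PoloidalLiouville` (1222), W1 and the summit stay OPEN; NO Navier–Stokes regularity statement is proved.
`--supports stmt-NavierStokesRegularity-1222 --as helper`.  [folklore]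
-/

noncomputable section

-- the summit and its single sub-problem share the name (CONVENTIONS §1)
set_option linter.dupNamespace false

open Set Function MeasureTheory

namespace Summit.NavierStokesRegularity.NavierStokesRegularity.Theorems.PoloidalLiouville.NetFlux

open Literature.Analysis.FluidPDE

/-- **The Type-I wall modulo the multi-hill residual**: `MultiHillScalarLiouvilleTypeI` ⇒ g0's `FarPastCollapse.StubScalarLiouvilleTypeI`
(statement verbatim) — case split between the saddle-free stratum (the rung `unimodalScalarLiouvilleTypeI_holds`) and the residual.
Bookkeeping; no NS statement is proved. [folklore] -/
theorem scalarLiouvilleTypeI_of_multiHill (hres : MultiHillScalarLiouvilleTypeI) :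
    ∀ (v : ℝ → E3 → E3) (x₀ : E3) (T : ℝ → E3 → ℝ),
    (∃ C : ℝ, HasTypeITimeDecay C v) →
    IsBoundedAncientMildSolution 1 v →
    (∀ t < 0, AEStronglyMeasurable (v t) volume) →
    ContDiffOn ℝ (⊤ : ℕ∞) (Function.uncurry v) (Set.Iio 0 ×ˢ Set.univ) →
    ContDiffOn ℝ (⊤ : ℕ∞) (Function.uncurry T) (Set.Iio 0 ×ˢ ({x₀}ᶜ : Set E3)) →
    (∃ C : ℝ, ∀ t < 0, ∀ x, |T t x| ≤ C) →
    (∀ t < 0, ∀ x, curl (v t) x = cross (gradient (T t) x) (x - x₀)) →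
    (∀ t < 0, ∀ x, x ≠ x₀ →
      cross (gradient (fun z => deriv (fun s => T s z) t + inner ℝ (v t z) (gradient (T t) z)
            - Laplacian.laplacian (T t) z) x) (x - x₀) =
        cross (gradient (fun z => inner ℝ (v t z) (z - x₀)) x) (gradient (T t) x)) →
    ∀ t < 0, ∀ x, cross (gradient (T t) x) (x - x₀) = 0 := by
  intro v x₀ T hC hB hm hsv hsT hTb hrep hE
  by_cases huni : ∀ t < 0, ∀ r > 0, IsUnimodalSphere (T t) x₀ r
  · exact unimodalScalarLiouvilleTypeI_holds v x₀ T hC hB hm hsv hsT hTb hrep (fun t ht => hE t ht) huni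
  · push Not at huni
    obtain ⟨t, ht, r, hr, hnot⟩ := huni
    exact hres v x₀ T hC hB hm hsv hsT hTb hrep (fun t ht => hE t ht) ⟨t, ht, r, hr, hnot⟩

/-- **C⁻ modulo the multi-hill residual**: `MultiHillScalarLiouvilleTypeI` ⇒ every Type-I unthreaded bounded ancient mild solution has
constant time slices (body of `FarPastCollapse.PoloidalLiouvilleTypeI` verbatim, `IsTypeIUnthreaded` unfolded): vorticity of class
(`stub_vorticityOfClass`), toroidal potential (`stub_toroidalPotential`), the curled law (`stub_potentialEvolution`), the Type-I wall modulo the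
residual (`scalarLiouvilleTypeI_of_multiHill`), constancy of irrotational slices (`stub_constantOfIrrotational`).  Bookkeeping; the residual, C⁻,
the crux and W1 stay OPEN; no NS statement is proved. [folklore] -/
theorem poloidalLiouvilleTypeI_of_multiHill (hres : MultiHillScalarLiouvilleTypeI) :
    ∀ v : ℝ → E3 → E3,
      ((∃ C : ℝ, HasTypeITimeDecay C v) ∧ IsBoundedAncientMildSolution 1 v ∧
        (∀ t < 0, AEStronglyMeasurable (v t) volume) ∧
        ContDiffOn ℝ (⊤ : ℕ∞) (Function.uncurry v) (Set.Iio 0 ×ˢ Set.univ) ∧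
        ∃ x₀ : E3, ∀ t < 0, ∀ x, inner ℝ (x - x₀) (curl (v t) x) = 0) →
      ∀ t < 0, ∃ b : E3, ∀ x, v t x = b := by
  intro v hv t ht
  obtain ⟨hC, hB, hm, hsm, x₀, hx₀⟩ := hv
  obtain ⟨hV, K, hK⟩ := stub_vorticityOfClass v hB hm hsm
  obtain ⟨T, hT, hTb, hrep⟩ := stub_toroidalPotential v x₀ K hsm hK hx₀
  have hE := stub_potentialEvolution v x₀ T hV hT hrep
  have h0 := scalarLiouvilleTypeI_of_multiHill hres v x₀ T hC hB hm hsm hT ⟨Real.pi * K, hTb⟩ hrep hE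
  have hcurl : ∀ s < 0, ∀ x, curl (v s) x = 0 := fun s hs x => by
    rw [hrep s hs x]
    exact h0 s hs x
  exact stub_constantOfIrrotational v hB hsm hcurl t ht

end Summit.NavierStokesRegularity.NavierStokesRegularity.Theorems.PoloidalLiouville.NetFlux

end
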